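/-
Copyright (c) 2026. All rights reserved.
Released under Apache 2.0 license as described in the file LICENSE.
-/
import Mathlib
import HarnessLib
import Summits.RiemannHypothesis.RiemannHypothesis.Theorems.EarlyAppointmentsExactCombBound

/-!
# Exact comb imaginary bound for CombDescentStep

For the exact comb sum at height h, the imaginary part is bounded by -π/s + 2/h.
This is a key building block for the G imaginary bound in CombDescentStep.

## Main result

* `exact_comb_im_bound`: For the exact comb sum, `exact_sum.im ≤ -π/s + 2/h`.

This follows from `norm_exactCombSum_le` which gives `‖exact_sum + iπ/s‖ ≤ 2/h`.
-/

open Complex Real Set Filter Topology Metric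
open scoped BigOperators Topology ComplexConjugate

noncomputable section

namespace EarlyAppointmentsExactCombImBound

/-- The exact comb imaginary bound from norm_exactCombSum_le.

For the exact comb sum at ih:
  ‖exact_sum + iπ/s‖ ≤ 2/h

This implies:
  |exact_sum.im + π/s| ≤ 2/h

Therefore:
  exact_sum.im ≤ -π/s + 2/h
-/
theorem exact_comb_im_bound {h s : ℝ} (hh : 0 < h) (hs : 0 < s) (hhs : 2 * s ≤ h) :
    let exact_sum := (1 / s : ℂ) * ∑' n : ℕ, (1 / (((h / s : ℝ) : ℂ) * I - (n + 1)) +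
                                               1 / (((h / s : ℝ) : ℂ) * I + (n + 1)))
    exact_sum.im ≤ -π / s + 2 / h := by
  intro exact_sum
  -- From norm_exactCombSum_le: ‖exact_sum + iπ/s‖ ≤ 2/h
  have hnorm := EarlyAppointmentsExactCombBound.norm_exactCombSum_le hh hs hhs
  -- |Im(z)| ≤ ‖z‖, so |(exact_sum + iπ/s).im| ≤ ‖exact_sum + iπ/s‖
  have hIπs_im : (I * (π / s) : ℂ).im = π / s := by simp
  have hsum_im : (exact_sum + I * (π / s)).im = exact_sum.im + π / s := by
    simp [add_im, hIπs_im]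
  have habs_im : |exact_sum.im + π / s| ≤ ‖exact_sum + I * (π / s)‖ := by
    rw [← hsum_im]
    exact abs_im_le_norm _
  -- The norm is ≤ 2/h
  have hnorm' : ‖exact_sum + I * (π / s)‖ ≤ 2 / h := by
    have heq : exact_sum + I * (π / s) = exact_sum + I * π / s := by ring
    rw [heq]
    exact hnorm
  have habs : |exact_sum.im + π / s| ≤ 2 / h := le_trans habs_im hnorm'
  have habs_le := abs_le.mp habs
  -- exact_sum.im + π/s ≤ 2/h, so exact_sum.im ≤ 2/h - π/s = -π/s + 2/h
  have h1 : exact_sum.im ≤ 2 / h - π / s := by linarith [habs_le.2]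
  have h2 : (2 : ℝ) / h - π / s = -π / s + 2 / h := by ring
  linarith

/-- Lower bound: exact_sum.im ≥ -π/s - 2/h. -/
theorem exact_comb_im_lower_bound {h s : ℝ} (hh : 0 < h) (hs : 0 < s) (hhs : 2 * s ≤ h) :
    let exact_sum := (1 / s : ℂ) * ∑' n : ℕ, (1 / (((h / s : ℝ) : ℂ) * I - (n + 1)) +
                                               1 / (((h / s : ℝ) : ℂ) * I + (n + 1)))
    (-π) / s - 2 / h ≤ exact_sum.im := by
  intro exact_sum
  have hnorm := EarlyAppointmentsExactCombBound.norm_exactCombSum_le hh hs hhs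
  have hIπs_im : (I * (π / s) : ℂ).im = π / s := by simp
  have hsum_im : (exact_sum + I * (π / s)).im = exact_sum.im + π / s := by
    simp [add_im, hIπs_im]
  have habs_im : |exact_sum.im + π / s| ≤ ‖exact_sum + I * (π / s)‖ := by
    rw [← hsum_im]
    exact abs_im_le_norm _
  have hnorm' : ‖exact_sum + I * (π / s)‖ ≤ 2 / h := by
    have heq : exact_sum + I * (π / s) = exact_sum + I * π / s := by ring
    rw [heq]
    exact hnorm
  have habs : |exact_sum.im + π / s| ≤ 2 / h := le_trans habs_im hnorm'
  have habs_le := abs_le.mp habs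
  have h1 : -(2 / h) ≤ exact_sum.im + π / s := habs_le.1
  -- -(2/h) ≤ exact_sum.im + π/s means exact_sum.im ≥ -(2/h) - π/s = -π/s - 2/h
  have h2 : exact_sum.im ≥ -(2 / h) - π / s := by linarith
  have h3 : -((2 : ℝ) / h) - π / s = (-π) / s - 2 / h := by ring
  rw [h3] at h2
  exact h2

end EarlyAppointmentsExactCombImBound

end
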